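import Summits.KontsevichZagierPeriods.KontsevichZagierPeriods.Theorems.LinRedNormalFormArrangementNormalFormSeparateTwoPosPiece
import Summits.KontsevichZagierPeriods.KontsevichZagierPeriods.Theorems.LinRedNormalFormArrangementNormalFormSeparateTwoPosTerminal
import Summits.KontsevichZagierPeriods.KontsevichZagierPeriods.Theorems.LinRedNormalFormArrangementNormalFormSeparateTwoPosDissect

/-!
# `stub_separateTwoPos`: separation in a good rational direction, planar base with fibres

(Line `janus-bands`, crux `ArrangementNormalForm`, stub `stub_separateTwoPos` — separation in
base dimension `2` with `k + 1 ≥ 1` fibres; the ASSEMBLY.)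

A Janus band representation with base `(x, y)` in a bounded rational polygon and `k` fibres
(literal `JJ 2 k` data: integrand `p(x, y)/∏ Lⱼ(x, y)^{eⱼ} × ∏ᵢ 1/(tᵢ − cᵢ(x, y))`, fibre bounds
other fibres or affine forms of the base) is congruent modulo `KZ.relations` to a
`ℤ`-combination of SEPARATED representations (`GG 1 1 k`), GIVEN as hypothesis `hHI` the
termwise absolute convergence of the Taylor split of the terminal pieces (the analytic lemma
`stub_separateTwoPos_hI`, universally closed): `separateTwoPos_core` (every `k`; registered
part) and the stub `stub_separateTwoPos` (literal classes, `k + 1` fibres). Pipeline (the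
fibre-free `stub_separateTwoZero` with the fibres riding along): the planar good-direction
dissection of the base (`SepTwoPos.dissect`: cuts along letters, pencils and separators,
pigeonhole choice of a direction, rule (2) base change), then on each good piece the far-first
separation (`SepTwoPos.piece_theorem`, `SepTwoPos.sepV_induction`: far letters first while
their walls are harmless, then the near pairs at the special vertex, maintaining the wall
invariant) and the terminal step (`SepTwoPos.terminal`: the wall invariant gives `hH`, `hHI`
gives `hI`, `separatePos_split`). Degenerate zero letters give the zero integrand.
-/

noncomputable section

open Set MeasureTheory Filter Topology

namespace Summit.KontsevichZagierPeriods.ArrangementNormalForm.JanusBands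

open Literature.NumberTheory.Transcendental

open SepTwoPos SepTwoZero SeparatePos in
/-- **Separation in base dimension `2` with `k` fibres, core form** (registered part of
`stub_separateTwoPos`): a planar Janus band representation with `k` fibres (polygonal base
cell × fibres `SeparatePos.gDom 1 k`, integrand `p/∏ Lⱼ^{eⱼ} · (fibre block)`) is congruent
modulo `KZ.relations` to a `ℤ`-combination of elements of `SeparatePos.GGset 1 1 k`, given the
termwise-convergence lemma `hHI` of the Taylor split: `SepTwoPos.dissect` (rules 1a, 2) +
`SepTwoPos.piece_theorem` (far-first engine, rule 1b) + `SepTwoPos.terminal` (`hH` from the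
wall invariant, `hI := hHI`, `separatePos_split`); degenerate zero letters give the zero
integrand. [Kontsevich–Zagier 2001, §1.2] -/
theorem separateTwoPos_core (k : ℕ) (hHI : ∀ (b k m m' n : ℕ) (s : KZ.IntegralRep (b + 1 + k)) (M : Fin m' → (Fin (b + 1) → ℚ) × ℚ) (L : Fin m → (Fin b → ℚ) × ℚ) (e : Fin m → ℕ) (p : MvPolynomial (Fin (b + 1)) ℚ) (ℓ : (Fin b → ℚ) × ℚ) (a : Fin k → Option ((Fin (b + 1) → ℚ) × ℚ)) (lo hi : Fin k → Fin k ⊕ ((Fin (b + 1) → ℚ) × ℚ)) (hpole : n ≠ 0 → ∀ z ∈ s.domain, (z (Fin.castAdd k (Fin.last b)) - (∑ i, (ℓ.1 i : ℝ) * z (Fin.castAdd k (Fin.castSucc i)) + (ℓ.2 : ℝ))) ≠ 0) (hbd : Bornology.IsBounded s.domain) (hdom : s.domain = {z | (∀ j, 0 < ∑ i, ((M j).1 i : ℝ) * z (Fin.castAdd k i) + ((M j).2 : ℝ)) ∧ ∀ i, Sum.elim (fun j => z (Fin.natAdd (b + 1) j)) (fun c => ∑ i', (c.1 i' : ℝ)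 * z (Fin.castAdd k i') + (c.2 : ℝ)) (lo i) < z (Fin.natAdd (b + 1) i) ∧ z (Fin.natAdd (b + 1) i) < Sum.elim (fun j => z (Fin.natAdd (b + 1) j)) (fun c => ∑ i', (c.1 i' : ℝ) * z (Fin.castAdd k i') + (c.2 : ℝ)) (hi i)}) (hint : EqOn s.integrand (fun z => MvPolynomial.aeval (fun i => z (Fin.castAdd k i)) p / (∏ j, (∑ i, ((L j).1 i : ℝ) * z (Fin.castAdd k (Fin.castSucc i)) + ((L j).2 : ℝ)) ^ e j) * (1 / (z (Fin.castAdd k (Fin.last b)) - (∑ i, (ℓ.1 i : ℝ) * z (Fin.castAdd k (Fin.castSucc i)) + (ℓ.2 : ℝ))) ^ n) * ∏ i, (a i).elim 1 (fun c => 1 / (z (Fin.natAdd (b + 1) i) - (∑ i', (c.1 i' : ℝ) * z (Fin.castAdd k i') + (c.2 : ℝ))))) s.domain) (N : ℕ) (q : ℕ → MvPolynomial (Fin b) ℚ) (hq : ∀ z : Fin (b + 1 + k) → ℝ, MvPolynomial.aeval (fun i => z (Fin.castAdd k i)) p = ∑ i ∈ Finset.range N, MvPolynomial.aeval (fun i =>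 z (Fin.castAdd k (Fin.castSucc i))) (q i) * (z (Fin.castAdd k (Fin.last b)) - (∑ i, (ℓ.1 i : ℝ) * z (Fin.castAdd k (Fin.castSucc i)) + (ℓ.2 : ℝ))) ^ i) (hb : b = 1) (hH : ∀ j, e j ≠ 0 → ∀ z ∈ closure s.domain, (∑ i, ((L j).1 i : ℝ) * z (Fin.castAdd k (Fin.castSucc i)) + ((L j).2 : ℝ)) = 0 → (n ≠ 0 ∧ z (Fin.castAdd k (Fin.last b)) = ∑ i, (ℓ.1 i : ℝ) * z (Fin.castAdd k (Fin.castSucc i)) + (ℓ.2 : ℝ))), ∀ i ∈ Finset.range N, IntegrableOn (fun z => MvPolynomial.aeval (fun i => z (Fin.castAdd k (Fin.castSucc i))) (q i) / (∏ j, (∑ i, ((L j).1 i : ℝ) * z (Fin.castAdd k (Fin.castSucc i)) + ((L j).2 : ℝ)) ^ e j) * ((z (Fin.castAdd k (Fin.last b)) - (∑ i, (ℓ.1 i : ℝ) * z (Fin.castAdd k (Fin.castSucc i)) + (ℓ.2 : ℝ))) ^ i / (z (Fin.castAdd k (Fin.last b)) - (∑ i, (ℓ.1 i : ℝ) * z (Fin.castAdd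 k (Fin.castSucc i)) + (ℓ.2 : ℝ))) ^ n) * ∏ i, (a i).elim 1 (fun c => 1 / (z (Fin.natAdd (b + 1) i) - (∑ i', (c.1 i' : ℝ) * z (Fin.castAdd k i') + (c.2 : ℝ))))) s.domain) (m m' : ℕ) (s : KZ.IntegralRep (1 + 1 + k)) (M : Fin m' → (Fin (1 + 1) → ℚ) × ℚ) (L : Fin m → (Fin (1 + 1) → ℚ) × ℚ) (e : Fin m → ℕ) (p : MvPolynomial (Fin (1 + 1)) ℚ) (a : Fin k → Option ((Fin (1 + 1) → ℚ) × ℚ)) (lo hi : Fin k → Fin k ⊕ ((Fin (1 + 1) → ℚ) × ℚ)) (hbd : Bornology.IsBounded s.domain) (hdom : s.domain = SeparatePos.gDom 1 k m' M lo hi) (hint : EqOn s.integrand (fun z => MvPolynomial.aeval (fun i => z (Fin.castAdd k i)) p / (∏ j, SeparatePos.affF 1 k (L j) z ^ e j) * SeparatePos.fib 1 k a z) s.domain) : ∃ c ∈ AddSubgroup.closure (SeparatePos.GGset 1 1 k), KZ.of s - c ∈ KZ.relations := by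
  classical
  by_cases hL : ∀ i, e i ≠ 0 → L i ≠ 0
  · obtain ⟨c, hc, hrel⟩ := SepTwoPos.dissect (k := k)
      {w | ∃ c ∈ AddSubgroup.closure (GGset 1 1 k), w - c ∈ KZ.relations}
      (fun m₁ m₁' s₁ M₁ L₁ e₁ p₁ a₁ lo₁ hi₁ 𝒳 hbd₁ hdom₁ hint₁ HX Ha Hb hpole Hv =>
        SepTwoPos.piece_theorem (k := k)
          (fun m₂' r M₂ p₂ lam a₂ lo₂ up₂ V m₂ L₂ e₂ d s₂ ℓ h1 h2 h3 h4 h5 h6 =>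
            SepTwoPos.terminal M₂ p₂ lam a₂ lo₂ up₂ V hHI L₂ e₂ d s₂ ℓ h1 h2 h3 h4 h5 h6)
          s₁ M₁ L₁ e₁ p₁ a₁ lo₁ hi₁ hbd₁ hdom₁ hint₁ 𝒳 HX Ha Hb hpole Hv)
      m m' s M L e p a lo hi hbd hdom hint hL
    obtain ⟨c', hc', hcc⟩ := closure_transfer' (fun x hx => hx) c hc
    refine ⟨c', hc', ?_⟩
    have := add_mem hrel hcc
    rwa [sub_add_sub_cancel] at this
  · push Not at hL
    obtain ⟨i, hei, hLi⟩ := hL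
    refine ⟨0, zero_mem _, ?_⟩
    rw [sub_zero]
    refine KZ.of_mem_relations_of_eqOn_zero s fun z hz => ?_
    rw [hint hz]
    have h0 : affF 1 k (L i) z ^ e i = 0 := by
      rw [hLi]; simp [affF, zero_pow hei]
    simp only [Pi.zero_apply]
    rw [Finset.prod_eq_zero (Finset.mem_univ i) h0, div_zero, zero_mul]

open SepTwoPos SepTwoZero SeparatePos in
/-- **stub_separateTwoPos** (line `janus-bands`, crux `ArrangementNormalForm`): SEPARATION in base
dimension `2` with `k + 1 ≥ 1` fibres. Every Janus band representation with literal
`JJ 2 (k + 1)` data is congruent modulo `KZ.relations` to a `ℤ`-combination of elements of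
`GG 1 1 (k + 1)`, given the termwise-convergence lemma `hHI` of the Taylor split
(`stub_separateTwoPos_hI`): `separateTwoPos_core` on the literal data.
[Kontsevich–Zagier 2001, §1.2] -/
theorem stub_separateTwoPos (JJ : ℕ → ℕ → Set KZ.FormalRep) (GG : ℕ → ℕ → ℕ → Set KZ.FormalRep) (hJJ : ∀ b k, JJ b k = {w : KZ.FormalRep | ∃ (m m' : ℕ) (s : KZ.IntegralRep (b + k)) (M : Fin m' → (Fin b → ℚ) × ℚ) (L : Fin m → (Fin b → ℚ) × ℚ) (e : Fin m → ℕ) (p : MvPolynomial (Fin b) ℚ) (a : Fin k → Option ((Fin b → ℚ) × ℚ)) (lo hi : Fin k → Fin k ⊕ ((Fin b → ℚ) × ℚ)), Bornology.IsBounded s.domain ∧ s.domain = {z | (∀ j, 0 < ∑ i, ((M j).1 i : ℝ) * z (Fin.castAdd k i) + ((M j).2 : ℝ)) ∧ ∀ i, Sum.elim (fun j => z (Fin.natAdd b j)) (fun c => ∑ i', (c.1 i' : ℝ) * z (Fin.castAdd k i') + (c.2 : ℝ)) (lo i) < z (Fin.natAdd b i) ∧ z (Fin.natAdd b i) < Sum.elim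 (fun j => z (Fin.natAdd b j)) (fun c => ∑ i', (c.1 i' : ℝ) * z (Fin.castAdd k i') + (c.2 : ℝ)) (hi i)} ∧ EqOn s.integrand (fun z => MvPolynomial.aeval (fun i => z (Fin.castAdd k i)) p / (∏ j, (∑ i, ((L j).1 i : ℝ) * z (Fin.castAdd k i) + ((L j).2 : ℝ)) ^ e j) * ∏ i, (a i).elim 1 (fun c => 1 / (z (Fin.natAdd b i) - (∑ i', (c.1 i' : ℝ) * z (Fin.castAdd k i') + (c.2 : ℝ))))) s.domain ∧ w = KZ.of s}) (hGG : ∀ b σ k, GG b σ k = {w : KZ.FormalRep | ∃ (m m' n₁ n₂ : ℕ) (s : KZ.IntegralRep (b + 1 + k)) (M : Fin m' → (Fin (b + 1) → ℚ) × ℚ) (L : Fin m → (Fin b → ℚ) × ℚ) (e : Fin m → ℕ) (p : MvPolynomial (Fin b) ℚ) (ℓ₁ ℓ₂ : (Fin b → ℚ) × ℚ) (a : Fin k → Option ((Fin (b + 1) → ℚ) × ℚ)) (lo hi : Fin k → Fin k ⊕ ((Fin (b + 1) → ℚ) × ℚ)), (n₁ = 0 ∨ n₂ = 0) ∧ (σ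 = 2 → (∀ i c, a i = some c → c.1 (Fin.last b) = 0) ∧ (∀ i c, (lo i = Sum.inr c ∨ hi i = Sum.inr c) → (c.1 (Fin.last b) = 0 ∨ c = (Pi.single (Fin.last b) 1, 0)))) ∧ Bornology.IsBounded s.domain ∧ s.domain = {z | (∀ j, 0 < ∑ i, ((M j).1 i : ℝ) * z (Fin.castAdd k i) + ((M j).2 : ℝ)) ∧ ∀ i, Sum.elim (fun j => z (Fin.natAdd (b + 1) j)) (fun c => ∑ i', (c.1 i' : ℝ) * z (Fin.castAdd k i') + (c.2 : ℝ)) (lo i) < z (Fin.natAdd (b + 1) i) ∧ z (Fin.natAdd (b + 1) i) < Sum.elim (fun j => z (Fin.natAdd (b + 1) j)) (fun c => ∑ i', (c.1 i' : ℝ) * z (Fin.castAdd k i') + (c.2 : ℝ)) (hi i)} ∧ EqOn s.integrand (fun z => MvPolynomial.aeval (fun i => z (Fin.castAdd k (Fin.castSucc i))) p / (∏ j, (∑ i, ((L j).1 i : ℝ) * z (Fin.castAdd k (Fin.castSucc i)) + ((L j).2 : ℝ)) ^ e j) * ((z (Fin.castAdd k (Fin.last b)) - (∑ i, (ℓ₁.1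 i : ℝ) * z (Fin.castAdd k (Fin.castSucc i)) + (ℓ₁.2 : ℝ))) ^ n₁ / (z (Fin.castAdd k (Fin.last b)) - (∑ i, (ℓ₂.1 i : ℝ) * z (Fin.castAdd k (Fin.castSucc i)) + (ℓ₂.2 : ℝ))) ^ n₂) * ∏ i, (a i).elim 1 (fun c => 1 / (z (Fin.natAdd (b + 1) i) - (∑ i', (c.1 i' : ℝ) * z (Fin.castAdd k i') + (c.2 : ℝ))))) s.domain ∧ w = KZ.of s}) (hHI : ∀ (b k m m' n : ℕ) (s : KZ.IntegralRep (b + 1 + k)) (M : Fin m' → (Fin (b + 1) → ℚ) × ℚ) (L : Fin m → (Fin b → ℚ) × ℚ) (e : Fin m → ℕ) (p : MvPolynomial (Fin (b + 1)) ℚ) (ℓ : (Fin b → ℚ) × ℚ) (a : Fin k → Option ((Fin (b + 1) → ℚ) × ℚ)) (lo hi : Fin k → Fin k ⊕ ((Fin (b + 1) → ℚ) × ℚ)) (hpole : n ≠ 0 → ∀ z ∈ s.domain, (z (Fin.castAdd k (Fin.last b)) - (∑ i, (ℓ.1 i : ℝ) * z (Fin.castAdd k (Fin.castSucc i)) + (ℓ.2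 : ℝ))) ≠ 0) (hbd : Bornology.IsBounded s.domain) (hdom : s.domain = {z | (∀ j, 0 < ∑ i, ((M j).1 i : ℝ) * z (Fin.castAdd k i) + ((M j).2 : ℝ)) ∧ ∀ i, Sum.elim (fun j => z (Fin.natAdd (b + 1) j)) (fun c => ∑ i', (c.1 i' : ℝ) * z (Fin.castAdd k i') + (c.2 : ℝ)) (lo i) < z (Fin.natAdd (b + 1) i) ∧ z (Fin.natAdd (b + 1) i) < Sum.elim (fun j => z (Fin.natAdd (b + 1) j)) (fun c => ∑ i', (c.1 i' : ℝ) * z (Fin.castAdd k i') + (c.2 : ℝ)) (hi i)}) (hint : EqOn s.integrand (fun z => MvPolynomial.aeval (fun i => z (Fin.castAdd k i)) p / (∏ j, (∑ i, ((L j).1 i : ℝ) * z (Fin.castAdd k (Fin.castSucc i)) + ((L j).2 : ℝ)) ^ e j) * (1 / (z (Fin.castAdd k (Fin.last b)) - (∑ i, (ℓ.1 i : ℝ) * z (Fin.castAdd k (Fin.castSucc i)) + (ℓ.2 : ℝ))) ^ n) * ∏ i, (a i).elim 1 (fun c => 1 / (z (Fin.natAdd (b + 1) i) - (∑ i', (c.1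 i' : ℝ) * z (Fin.castAdd k i') + (c.2 : ℝ))))) s.domain) (N : ℕ) (q : ℕ → MvPolynomial (Fin b) ℚ) (hq : ∀ z : Fin (b + 1 + k) → ℝ, MvPolynomial.aeval (fun i => z (Fin.castAdd k i)) p = ∑ i ∈ Finset.range N, MvPolynomial.aeval (fun i => z (Fin.castAdd k (Fin.castSucc i))) (q i) * (z (Fin.castAdd k (Fin.last b)) - (∑ i, (ℓ.1 i : ℝ) * z (Fin.castAdd k (Fin.castSucc i)) + (ℓ.2 : ℝ))) ^ i) (hb : b = 1) (hH : ∀ j, e j ≠ 0 → ∀ z ∈ closure s.domain, (∑ i, ((L j).1 i : ℝ) * z (Fin.castAdd k (Fin.castSucc i)) + ((L j).2 : ℝ)) = 0 → (n ≠ 0 ∧ z (Fin.castAdd k (Fin.last b)) = ∑ i, (ℓ.1 i : ℝ) * z (Fin.castAdd k (Fin.castSucc i)) + (ℓ.2 : ℝ))), ∀ i ∈ Finset.range N, IntegrableOn (fun z => MvPolynomial.aeval (fun i => z (Fin.castAdd k (Fin.castSucc i))) (q i) / (∏ j, (∑ i, ((L j).1 i : ℝ) * z (Fin.castAdd k (Fin.castSucc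 i)) + ((L j).2 : ℝ)) ^ e j) * ((z (Fin.castAdd k (Fin.last b)) - (∑ i, (ℓ.1 i : ℝ) * z (Fin.castAdd k (Fin.castSucc i)) + (ℓ.2 : ℝ))) ^ i / (z (Fin.castAdd k (Fin.last b)) - (∑ i, (ℓ.1 i : ℝ) * z (Fin.castAdd k (Fin.castSucc i)) + (ℓ.2 : ℝ))) ^ n) * ∏ i, (a i).elim 1 (fun c => 1 / (z (Fin.natAdd (b + 1) i) - (∑ i', (c.1 i' : ℝ) * z (Fin.castAdd k i') + (c.2 : ℝ))))) s.domain) (k : ℕ) : ∀ x ∈ JJ 2 (k + 1), ∃ c ∈ AddSubgroup.closure (GG 1 1 (k + 1)), x - c ∈ KZ.relations := by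
  intro x hx
  rw [hJJ] at hx
  obtain ⟨m, m', s, M, L, e, p, a, lo, hi, hbd, hdom, hint, rfl⟩ := hx
  rw [show GG 1 1 (k + 1) = GGset 1 1 (k + 1) from hGG 1 1 (k + 1)]
  exact separateTwoPos_core (k + 1) hHI m m' s M L e p a lo hi hbd hdom hint

end Summit.KontsevichZagierPeriods.ArrangementNormalForm.JanusBands
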